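import Literature.AlgebraicGeometry.Frobenioids.ArithmeticRealificationOrderCompat
import HarnessLib

/-!
# Frobenioids I, Theorem 6.4 (ii): uniformity of `deg(Ψ^rlf)` from SCALED naturality — sub-DAG row T64ii/L04,
# piece E2 of the (E) decomposition

Mochizuki, *The geometry of Frobenioids I: the general theory*, Kyushu J. Math. **62** (2008) 293–400, §6,
Theorem 6.4 (ii), kurims text p. 114 ("there exists an element `deg(Ψ^rlf) ∈ ℝ_{>0}` …") with proof p. 115 l. 34 –
p. 116 l. 3, and Example 6.3 p. 113–114 (the arithmetic degree `deg^arith_L`, NOT normalised by `[L : ℚ]`)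
[cite: MochizukiFrdI2008, Thm. 6.4 (ii) p.114].

PROOF-ONLY (cell abc-iut, sub-DAG `plan/L1/SUBDAG-FrdI-Thm64.md` row **T64ii/L04**, piece **E2** of seat
abc-iut-w4-d086's (E) decomposition (cell STATUS 2026-08-26T04:41:50Z); seat abc-iut-w5-d137, second reader of the
(E) lane; 0 `def`).  Seat abc-iut-w4-d086's `Thm64ii_L04_uniform_of_naturality`
(`ArithmeticRealificationOrderCompat.lean`) derives the uniformity of the comparison constant from transports
`τ₁ : Pic_Φ(A) ≃ Pic_Φ(B)`, `τ₂ : Pic_Φ(ΨA) ≃ Pic_Φ(ΨB)` commuting with the `δ`'s ON THE NOSE.  With print's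
un-normalised arithmetic degree the transports that actually occur — pull-back of real divisor classes along a
morphism `Spec L_B → Spec L_A` of the base — satisfy instead `δ_B ∘ τ = [L_B : L_A] · δ_A` (that seat's FINDING:
`Σ_{w | v} e_w f_w = [L_B : L_A]`).  Here the uniformity is re-derived from such SCALED transports, with the SAME
natural-number factor `c = [L_B : L_A] = [L'_B : L'_A] ≥ 1` on both sides (the equality of the two degrees being
piece E3, "an equivalence of `FinSubextCat`'s preserves degrees of morphisms"): since `c` is a natural number, the
additivity of `t ↦ δ_{A₂}(picMap_A(δ_{A₁}⁻¹ t))` alone gives `c · φ_A(t / c) = φ_A(t)` — no linearisation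
(T64ii/L02–L03) is needed for this step:
* `Thm64ii_L04_uniform_of_scaledNaturality` — T64ii/L04 from scaled naturality;
* `Thm64ii_of_cones_of_scaledNaturality` — hence `Thm64ii R₁ R₂ Ψ picMap` from the cones (T64ii/L01 ⟹ L02, that
  seat's `Thm64ii_L02_orderCompat_of_cones`) and scaled naturality, via abc-iut-L6-t10's `Thm64ii_of_orderCompat_holds`.
Nothing here is specific to the abc programme or bears on [IUTchIII] Cor. 3.12; classical order/algebra.
-/

noncomputable section

namespace Literature.AlgebraicGeometry.Frobenioids

open CategoryTheory

universe u v

variable {F₁ : Type} [Field F₁] {K₁ : Type} [Field K₁] [Algebra F₁ K₁]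
variable {F₂ : Type} [Field F₂] {K₂ : Type} [Field K₂] [Algebra F₂ K₂]
variable {Rlf₁ : Type u} [Category.{v} Rlf₁] {Rlf₂ : Type u} [Category.{v} Rlf₂]
variable (R₁ : ArithRealification (F := F₁) (K := K₁) Rlf₁) (R₂ : ArithRealification (F := F₂) (K := K₂) Rlf₂)

/-- An additive map `φ : ℝ → ℝ` satisfies `c · φ (t / c) = φ t` for every natural number `c ≥ 1` (additivity only;
no linearity over `ℝ` is used). [folklore] -/
private theorem natCast_mul_map_div_natCast (φ : ℝ →+ ℝ) {c : ℕ} (hc : 0 < c) (t : ℝ) :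
    (c : ℝ) * φ (t / c) = φ t := by
  have hc' : (c : ℝ) ≠ 0 := Nat.cast_ne_zero.mpr (Nat.pos_iff_ne_zero.mp hc)
  rw [← nsmul_eq_mul, ← map_nsmul, nsmul_eq_mul, mul_div_cancel₀ t hc']

/-- **T64ii/L04 from SCALED naturality.** If any two Frobenius-trivial objects `A`, `B` of `C₁^rlf` are linked by
additive isomorphisms `τ₁ : Pic_Φ(A) ⥲ Pic_Φ(B)`, `τ₂ : Pic_Φ(ΨA) ⥲ Pic_Φ(ΨB)` intertwining `picMap` and scaling
the degree maps by the SAME natural number `c ≥ 1` on both sides (`δ_B ∘ τ₁ = c · δ_A`, `δ_{ΨB} ∘ τ₂ = c · δ_{ΨA}`: the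
pull-backs of real divisor classes along the connected base, `c = [L_B : L_A]` for the un-normalised arithmetic
degree of Ex. 6.3), then the composites `δ_{A₂} ∘ picMap_A ∘ δ_{A₁}⁻¹ : ℝ → ℝ` do not depend on `A` — "there
exists an element `deg(Ψ^rlf)`" (ONE constant). [cite: MochizukiFrdI2008, Thm. 6.4 (ii) p.114] -/
theorem Thm64ii_L04_uniform_of_scaledNaturality (Ψ : Rlf₁ ≌ Rlf₂)
    (picMap : ∀ A : Rlf₁, R₁.Pic A ≃+ R₂.Pic (Ψ.functor.obj A))
    (hnat : ∀ (A B : Rlf₁) (hA : R₁.ops.IsFrobeniusTrivial A) (hA' : R₂.ops.IsFrobeniusTrivial (Ψ.functor.obj A))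
      (hB : R₁.ops.IsFrobeniusTrivial B) (hB' : R₂.ops.IsFrobeniusTrivial (Ψ.functor.obj B)),
      ∃ (c : ℕ) (τ₁ : R₁.Pic A ≃+ R₁.Pic B) (τ₂ : R₂.Pic (Ψ.functor.obj A) ≃+ R₂.Pic (Ψ.functor.obj B)),
        0 < c ∧ (∀ x, R₁.δ B hB (τ₁ x) = c * R₁.δ A hA x) ∧ (∀ y, R₂.δ _ hB' (τ₂ y) = c * R₂.δ _ hA' y) ∧
        ∀ x, picMap B (τ₁ x) = τ₂ (picMap A x)) :
    ∀ (A B : Rlf₁) (hA : R₁.ops.IsFrobeniusTrivial A) (hA' : R₂.ops.IsFrobeniusTrivial (Ψ.functor.obj A))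
      (hB : R₁.ops.IsFrobeniusTrivial B) (hB' : R₂.ops.IsFrobeniusTrivial (Ψ.functor.obj B)) (t : ℝ),
      R₂.δ _ hA' (picMap A ((R₁.δ A hA).symm t)) = R₂.δ _ hB' (picMap B ((R₁.δ B hB).symm t)) := by
  intro A B hA hA' hB hB' t
  obtain ⟨c, τ₁, τ₂, hc, hδ₁, hδ₂, hpm⟩ := hnat A B hA hA' hB hB'
  have hc' : (c : ℝ) ≠ 0 := Nat.cast_ne_zero.mpr (Nat.pos_iff_ne_zero.mp hc)
  -- the composite `φ_A : t ↦ δ_{ΨA}(picMap_A(δ_A⁻¹ t))` as an additive homomorphism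
  let φA : ℝ →+ ℝ :=
    (R₂.δ _ hA').toAddMonoidHom.comp ((picMap A).toAddMonoidHom.comp (R₁.δ A hA).symm.toAddMonoidHom)
  have hφA : ∀ s, φA s = R₂.δ _ hA' (picMap A ((R₁.δ A hA).symm s)) := fun _ => rfl
  -- `δ_B⁻¹ t = τ₁ (δ_A⁻¹ (t / c))` since `δ_B ∘ τ₁ = c · δ_A`
  have h1 : (R₁.δ B hB).symm t = τ₁ ((R₁.δ A hA).symm (t / c)) := by
    apply (R₁.δ B hB).injective
    rw [(R₁.δ B hB).apply_symm_apply, hδ₁, (R₁.δ A hA).apply_symm_apply, mul_div_cancel₀ t hc']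
  rw [h1, hpm, hδ₂, ← hφA, ← hφA, natCast_mul_map_div_natCast φA hc t]

/-- **Theorem 6.4 (ii) from the cones and SCALED naturality**: `picMap` carries the non-negative cones into each
other (T64ii/L01 ⟹ L02, seat abc-iut-w4-d086's `Thm64ii_L02_orderCompat_of_cones`) and is natural along the base up
to the common degree factor (T64ii/L04 above); then `Thm64ii R₁ R₂ Ψ picMap` via abc-iut-L6-t10's
`Thm64ii_of_orderCompat_holds` (which uses T64ii/L03). [cite: MochizukiFrdI2008, Thm. 6.4 (ii) p.116] -/
theorem Thm64ii_of_cones_of_scaledNaturality (Ψ : Rlf₁ ≌ Rlf₂)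
    (picMap : ∀ A : Rlf₁, R₁.Pic A ≃+ R₂.Pic (Ψ.functor.obj A))
    (hcone : ∀ (A : Rlf₁) (hA : R₁.ops.IsFrobeniusTrivial A)
      (hA' : R₂.ops.IsFrobeniusTrivial (Ψ.functor.obj A)) (x : R₁.Pic A),
      0 ≤ R₁.δ A hA x → 0 ≤ R₂.δ _ hA' (picMap A x))
    (hnat : ∀ (A B : Rlf₁) (hA : R₁.ops.IsFrobeniusTrivial A) (hA' : R₂.ops.IsFrobeniusTrivial (Ψ.functor.obj A))
      (hB : R₁.ops.IsFrobeniusTrivial B) (hB' : R₂.ops.IsFrobeniusTrivial (Ψ.functor.obj B)),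
      ∃ (c : ℕ) (τ₁ : R₁.Pic A ≃+ R₁.Pic B) (τ₂ : R₂.Pic (Ψ.functor.obj A) ≃+ R₂.Pic (Ψ.functor.obj B)),
        0 < c ∧ (∀ x, R₁.δ B hB (τ₁ x) = c * R₁.δ A hA x) ∧ (∀ y, R₂.δ _ hB' (τ₂ y) = c * R₂.δ _ hA' y) ∧
        ∀ x, picMap B (τ₁ x) = τ₂ (picMap A x)) :
    Thm64ii R₁ R₂ Ψ picMap :=
  Thm64ii_of_orderCompat_holds R₁ R₂ Ψ picMap (Thm64ii_L02_orderCompat_of_cones R₁ R₂ Ψ picMap hcone)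
    (Thm64ii_L04_uniform_of_scaledNaturality R₁ R₂ Ψ picMap hnat)

end Literature.AlgebraicGeometry.Frobenioids

end
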